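import Summits.QuantumFields.BalabanUV.T4Continuum.Support.NE7CoarseCurlEnergyCurved
import Summits.QuantumFields.BalabanUV.T4Continuum.Support.NE3TangentCovariantStructure
import HarnessLib

/-!
# NE7QbarMassLetter — THE STRAIGHT PART OF THE LINEARISED AVERAGE CONTRACTS THE `ℓ²` MASS (ROOT FORM, MINKOWSKI):
# `√(Σ_{z,κ} ‖Q̄_W Y (z,κ)‖²_{HS∕n}) ≤ √(L²∕L^d)·√(Σ_{x,κ} ‖Y(x,κ)‖²_{HS∕n}) + √massErrC(d,L)·massRemC(d,L)·loopRad(d,L,a)·√‖Y‖²_{ℓ²}`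
# (lineage `b2b-balaban-t4-ne7-p1`, gen 117, file F3b; ROAD-G116 §7∕§9 (G1), the level-mass letter for the FRAME-CORRECTED tower)

Cell `pub-balaban`, rung (B)+1 sub-cell t4, CRUX PROVER NE7 #1 (OWNER of row NE7), generation 117.  The linearised one-step average splits as `cpush = Q̄ + gaugeDir (cavg W) F̄`
(✓ `NE3TangentCovariantStructure.cpush_eq_Qbar_add_gaugeDir`; `Q̄ = Qbar` the linearised DOUBLE-BAR average read on the coarse lattice, `F̄ = Fbar` the linearised frame).  The frame part is a
coarse GAUGE direction — it does not contract (✓ `NE7DirIterL1Letter`), and on corner-charge gauge directions the naive tower inequality «coarse curl energy ≤ fine energy + scaled fine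
mass» FAILS (this generation's memo); the straight part `Q̄` DOES contract, in `ℓ¹` by `L∕L^d + O(a)` (✓ `NE7QbarIterL1Letter.dirL1_Qbar_le`) and — THIS FILE — in the normalised
Hilbert–Schmidt mass, IN ROOT FORM, by `√(L²∕L^d)` plus an `O(a)·√(ℓ² mass)` remainder (sharp main constant: `L^{−1}` per step on roots in `d = 4`).
METHOD ([folklore]): leaf-10's decomposition ✓ `BlockAverageDbarLinBound.norm_dbarLin_sub_main_le` (`dbarLin = Ad_{V̄⁻¹} S + E`, `‖E‖ ≤ w·(local ℓ¹)`, `w = loopRad`), the transported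
straight sums written out (`dhol_seg_eq_sum`), Jensen in the HS currency (the transports are isometries, ✓ `nhsNormSq_Ad`), Minkowski (✓ `abs_hsRe_le` + Mathlib's `Real.sum_sqrt_mul_sqrt_le`), the tiling of the
fine torus by blocks (✓ `sum_blocks_eq`, ✓ `sum_periodBox_shift`: every fine bond is read `L` times with weight `L^{−d}`) and the box multiplicity (✓ `sum_periodBox_box_le`).
WHAT (0 sorry): `dhol_seg_eq_sum`, `nhsNormSq_lineAvg_le`, `nhsNormSq_segMain_le`, `treeL1'_le_box`, `lnorm_seg_le_box`, `norm_Qbar_sub_Ad_segMain_le` (pointwise remainder),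
**`sqrt_sum_nhsNormSq_add_le`** (MINKOWSKI in the HS currency — the tower runs on ROOTS, so the main term suffers NO multiplicative loss), `sum_nhsNormSq_Ad_segMain_le`, `sum_normSq_Qbar_sub_le`,
**`sqrt_qbar_mass_le_curved`** (torus, root form: `√mass(Q̄Y) ≤ √(L²∕L^d)·√mass(Y) + √massErrC·massRemC·loopRad·√dirSq(Y)`).
HONEST FRAMING: lattice kinematics of ONE averaging step; constants polynomial in `d, L`, not optimised; nothing of Bałaban's asserted ((120)∕(125) pp. 35–36 context only); NOT (G′), NOT NE7
as a spine node, NOT NE3; spine 0∕9; finite T⁴ rung (B)+1 — NOT infinite volume, NOT mass gap, NOT BetaPertH, NOT Clay.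
-/

set_option autoImplicit false

open scoped BigOperators Matrix.Norms.L2Operator
open NormedSpace Finset

namespace Summit.QuantumFields.BalabanUV.T4Continuum.NE7QbarMassLetter

open Literature.MathematicalPhysics.QuantumFieldTheory.Balaban1983to89
open B7Prop1Explicit B7Prop2Explicit MatrixLog UnitaryModel
open T4AveragingDeficitWall (IsUnitaryCfg SmallField Ad dirL1 dirSq box)
open T4AveragingDeficitWallBoundary (IsPeriodicCfg periodBox blockSites_periodBox sum_blocks_eq sum_periodBox_shift)
open AveragingDeficitPeriodicCounting (IsPeriodicDir sum_periodBox_box_le)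
open AveragingDeficitCounting (card_box_eq)
open AveragingDeficitDerivCore (dirL1_nonneg)
open AveragingDeficitTransport (dhol dhol_nil dhol_cons dstep lnorm norm_Ad_of_unitary mem_U1_of_unitary)
open AveragingDeficitNearIdentity (Ad_add Ad_sum Ad_smul)
open T4AveragingDeficitNonAbelian (Ad_mul)
open AveragingDeficitChartCalculus (cavg)
open AveragingDeficitHSInner (nhsNormSq_smul nhsNormSq_add nhsNormSq_Ad hsRe abs_hsRe_le)
open AveragingDeficitPlaqLin (lnorm_le_region)
open AveragingDeficitBlockDensity (card_offsets_real)
open MatrixNorms (nhsNormSq nhsNorm nhsNormSq_nonneg nhsNormSq_le_opNorm_sq)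
open SpreadLift (loopRad loopRad_le)
open BlockAveragePushDirSplit (dbarLin sum_blockWeight_eq_one)
open BlockAverageDbarLinBound (segMain loopL1 treeL1' lnorm_nonneg norm_dbarLin_sub_main_le)
open NE3CovariantLineSumCore (nhsNormSq_sum_le_card_mul)
open NE3TangentCovariantStructure (Qbar)
open NE3EnergyHessContTwoTerm (dirSq_nonneg)
open NE7PushDirNearFlat (loopL1_add_seg_le_box bavg_mem_unitary loopL1_nonneg)
open NE7CoarseCurlEnergyCurved (dirL1_sq_le_card_mul_dirSq)

noncomputable section

variable {d : ℕ} {n : Type*} [Fintype n] [DecidableEq n]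

/-! ## §1 Transported straight sums written out; Jensen for line averages -/

/-- **THE LINEARISED TRANSPORT ALONG A FORWARD SEGMENT, WRITTEN OUT**: `(δ_ψ V)([x, x + k e_κ]) = Σ_{i<k} Ad_{V(x,…,x+(i+1)e_κ)} ψ(x + i e_κ, κ)` — each bond dressed by the transport up
to and including it. [cite: Balaban1985Averaging, (9) p.18, (56) p.27] -/
theorem dhol_seg_eq_sum (V : Site d → Fin d → (Matrix n n ℂ)ˣ) (ψ : Site d → Fin d → Matrix n n ℂ) (κ : Fin d) :
    ∀ (k : ℕ) (x : Site d), dhol V ψ x (seg κ (k : ℤ))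
      = ∑ i ∈ Finset.range k, Ad (hol V x (seg κ (((i + 1 : ℕ) : ℤ)))) (ψ (x + (i : ℤ) • e κ) κ)
  | 0, x => by simp
  | k + 1, x => by
      have hseg : ∀ m : ℕ, seg κ (((m + 1 : ℕ) : ℤ)) = ((κ, true) : Letter d) :: seg κ (m : ℤ) := fun m => by
        rw [seg_natCast, seg_natCast, List.replicate_succ]
      rw [hseg k, dhol_cons, stepHol_true, Letter.vec_true, dhol_seg_eq_sum V ψ κ k (x + e κ), Ad_sum, Finset.sum_range_succ' _ k]
      have hstep : dstep V ψ x ((κ, true) : Letter d) = Ad (V x κ) (ψ x κ) := by simp [dstep]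
      rw [hstep, add_comm]
      congr 1
      · refine Finset.sum_congr rfl fun i _ => ?_
        have h2 : hol V x (seg κ (((i + 1 + 1 : ℕ) : ℤ))) = V x κ * hol V (x + e κ) (seg κ (((i + 1 : ℕ) : ℤ))) := by
          rw [hseg (i + 1), hol_cons, stepHol_true, Letter.vec_true]
        have h3 : x + e κ + (i : ℤ) • (e κ : Site d) = x + ((i + 1 : ℕ) : ℤ) • e κ := by
          rw [Nat.cast_succ, add_zsmul, one_zsmul]; abel
        rw [← Ad_mul, ← h2, h3]
      · have h1 : hol V x (seg κ (((0 + 1 : ℕ) : ℤ))) = V x κ := by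
          rw [hseg 0, Nat.cast_zero, show seg κ (0 : ℤ) = [] from rfl, hol_cons, hol_nil, mul_one, stepHol_true]
        rw [h1]
        simp

omit [DecidableEq n] in
/-- **Jensen for the block average of line sums** (HS currency): `nhsNormSq (Σ_r L^{−d} • Σ_{i<L} A r i) ≤ (L∕L^d)·Σ_r Σ_i nhsNormSq (A r i)` (`L^{d+1}` terms of weight `L^{−d}`). [folklore] -/
theorem nhsNormSq_lineAvg_le [Nonempty n] (L : ℕ) [NeZero L] (A : (Fin d → Fin L) → ℕ → Matrix n n ℂ) :
    nhsNormSq (∑ r : Fin d → Fin L, (((L : ℝ) ^ d)⁻¹ : ℝ) • ∑ i ∈ Finset.range L, A r i)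
      ≤ (L : ℝ) / (L : ℝ) ^ d * ∑ r : Fin d → Fin L, ∑ i ∈ Finset.range L, nhsNormSq (A r i) := by
  have hL0 : (L : ℝ) ≠ 0 := by exact_mod_cast (NeZero.ne L)
  rw [← Finset.smul_sum, nhsNormSq_smul]
  set S : ℝ := ∑ r : Fin d → Fin L, ∑ i ∈ Finset.range L, nhsNormSq (A r i) with hS
  have h2 : ∀ r : Fin d → Fin L, nhsNormSq (∑ i ∈ Finset.range L, A r i) ≤ (L : ℝ) * ∑ i ∈ Finset.range L, nhsNormSq (A r i) := by
    intro r
    have h := nhsNormSq_sum_le_card_mul (Finset.range L) (fun i => A r i)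
    rwa [Finset.card_range] at h
  have h1 : nhsNormSq (∑ r : Fin d → Fin L, ∑ i ∈ Finset.range L, A r i) ≤ (L : ℝ) ^ d * ((L : ℝ) * S) := by
    have h := nhsNormSq_sum_le_card_mul (Finset.univ : Finset (Fin d → Fin L)) (fun r => ∑ i ∈ Finset.range L, A r i)
    rw [card_offsets_real] at h
    refine h.trans (mul_le_mul_of_nonneg_left ?_ (by positivity))
    calc ∑ r : Fin d → Fin L, nhsNormSq (∑ i ∈ Finset.range L, A r i)
        ≤ ∑ r : Fin d → Fin L, (L : ℝ) * ∑ i ∈ Finset.range L, nhsNormSq (A r i) := Finset.sum_le_sum fun r _ => h2 r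
      _ = (L : ℝ) * S := by rw [hS, Finset.mul_sum]
  calc ((((L : ℝ) ^ d)⁻¹ : ℝ)) ^ 2 * nhsNormSq (∑ r : Fin d → Fin L, ∑ i ∈ Finset.range L, A r i)
      ≤ ((((L : ℝ) ^ d)⁻¹ : ℝ)) ^ 2 * ((L : ℝ) ^ d * ((L : ℝ) * S)) := mul_le_mul_of_nonneg_left h1 (by positivity)
    _ = (L : ℝ) / (L : ℝ) ^ d * S := by field_simp

/-! ## §2 Pointwise: the main term by Jensen, the remainder by leaf-10's bound -/

/-- **THE MAIN TERM OF THE DOUBLE-BAR AVERAGE, HS JENSEN**: for `U(N)` data,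
`nhsNormSq (segMain L W Y q κ) ≤ (L∕L^d)·Σ_r Σ_{i<L} nhsNormSq (Y (q + x_r + i e_κ) κ)` (the transports `Ad_{W(Γ_{q,x})W([x, x+(i+1)e_κ])}` are HS isometries). [folklore] -/
theorem nhsNormSq_segMain_le [Nonempty n] (L : ℕ) [NeZero L] {W : Site d → Fin d → (Matrix n n ℂ)ˣ} (hW : IsUnitaryCfg W)
    (Y : Site d → Fin d → Matrix n n ℂ) (q : Site d) (κ : Fin d) :
    nhsNormSq (segMain L W Y q κ)
      ≤ (L : ℝ) / (L : ℝ) ^ d * ∑ r : Fin d → Fin L, ∑ i ∈ Finset.range L, nhsNormSq (Y (q + boxVec L r + (i : ℤ) • e κ) κ) := by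
  have hrepr : segMain L W Y q κ = ∑ r : Fin d → Fin L, (((L : ℝ) ^ d)⁻¹ : ℝ) • ∑ i ∈ Finset.range L,
      Ad (hol W q (treeWord (boxVec L r)) * hol W (q + boxVec L r) (seg κ (((i + 1 : ℕ) : ℤ)))) (Y (q + boxVec L r + (i : ℤ) • e κ) κ) := by
    unfold segMain
    refine Finset.sum_congr rfl fun r _ => ?_
    rw [dhol_seg_eq_sum, Ad_sum]
    simp only [Ad_mul]
  rw [hrepr]
  refine (nhsNormSq_lineAvg_le L _).trans (le_of_eq ?_)
  congr 1
  refine Finset.sum_congr rfl fun r _ => Finset.sum_congr rfl fun i _ => ?_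
  exact nhsNormSq_Ad ((unitaryUnits _).mul_mem (hol_mem_of hW _ _) (hol_mem_of hW _ _)) _

/-- The translated trees against the box: `treeL1' L Y q κ ≤ dL·dirL1 Y (box ((2d+2)L) q)`. [folklore] -/
theorem treeL1'_le_box {L : ℕ} (hL : 1 ≤ L) (Y : Site d → Fin d → Matrix n n ℂ) (q : Site d) (κ : Fin d) :
    treeL1' L Y q κ ≤ ((d * L : ℕ) : ℝ) * dirL1 Y (box ((2 * d + 2) * L) q) := by
  have hD0 := dirL1_nonneg Y (box ((2 * d + 2) * L) q)
  unfold treeL1'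
  have hq : l1 (q + (L : ℤ) • e κ - q) = L := by rw [add_sub_cancel_left]; exact BlockAverageCurrentNearId.l1_Lstep L κ
  calc ∑ r : Fin d → Fin L, ((L : ℝ) ^ d)⁻¹ * lnorm Y (q + (L : ℤ) • e κ) (treeWord (boxVec L r))
      ≤ ∑ _r : Fin d → Fin L, ((L : ℝ) ^ d)⁻¹ * (((d * L : ℕ) : ℝ) * dirL1 Y (box ((2 * d + 2) * L) q)) := by
        refine Finset.sum_le_sum fun r _ => mul_le_mul_of_nonneg_left ?_ (by positivity)
        have hlen : (treeWord (boxVec L r)).length ≤ d * L := by rw [length_treeWord]; exact l1_boxVec_le L r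
        have h := lnorm_le_region Y (z := q) (q := q + (L : ℤ) • e κ) (R := (2 * d + 2) * L) (treeWord (boxVec L r)) (by rw [hq]; nlinarith)
        exact h.trans (mul_le_mul_of_nonneg_right (by exact_mod_cast hlen) hD0)
    _ = ((d * L : ℕ) : ℝ) * dirL1 Y (box ((2 * d + 2) * L) q) := by rw [← Finset.sum_mul, sum_blockWeight_eq_one L hL, one_mul]

/-- The straight segment against the box: `‖Y‖_{ℓ¹(Γ_c)} ≤ L·dirL1 Y (box ((2d+2)L) q)`. [folklore] -/
theorem lnorm_seg_le_box (L : ℕ) (Y : Site d → Fin d → Matrix n n ℂ) (q : Site d) (κ : Fin d) :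
    lnorm Y q (seg κ L) ≤ (L : ℝ) * dirL1 Y (box ((2 * d + 2) * L) q) := by
  have hq0 : l1 (q - q) = 0 := by simp [l1]
  have hlen : (seg κ (L : ℤ)).length = L := by rw [length_seg, Int.natAbs_natCast]
  have h := lnorm_le_region Y (z := q) (q := q) (R := (2 * d + 2) * L) (seg κ L) (by rw [hq0, zero_add, hlen]; nlinarith)
  rw [hlen] at h
  exact h

/-- THE REMAINDER CONSTANT of the mass letter: `1250·((2d+2)L + L) + 8dL + 2L`. [folklore] -/
def massRemC (d L : ℕ) : ℝ := 1250 * ((((2 * d + 2) * L : ℕ) : ℝ) + L) + 8 * ((d * L : ℕ) : ℝ) + 2 * L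

omit [Fintype n] [DecidableEq n] in
/-- `0 ≤ massRemC d L`. [folklore] -/
theorem massRemC_nonneg (d L : ℕ) : 0 ≤ massRemC d L := by unfold massRemC; positivity

/-- **THE REMAINDER OF THE DOUBLE-BAR AVERAGE IN BOX CURRENCY**: for `U(N)` data `W` in the standard small-field class,
`‖Qbar L W Y z κ − Ad_{V̄(c)⁻¹} segMain L W Y (L•z) κ‖ ≤ massRemC d L · loopRad d L a · dirL1 Y (box ((2d+2)L) (L•z))` (✓ leaf-10's `norm_dbarLin_sub_main_le`, the local weights
against the box). [cite: Balaban1985Averaging, (120) p.35, (125) p.36] -/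
theorem norm_Qbar_sub_Ad_segMain_le [Nonempty n] {L : ℕ} (hL : 1 ≤ L) {W : Site d → Fin d → (Matrix n n ℂ)ˣ} (hW : IsUnitaryCfg W)
    {a : ℝ} (ha : 0 ≤ a) (h512 : 512 * (d + 1) * (d + 4) * (L : ℝ) ^ 2 * a ≤ 1) (hWa : SmallField W a)
    (Y : Site d → Fin d → Matrix n n ℂ) (z : Site d) (κ : Fin d) :
    ‖Qbar L W Y z κ - Ad (bavg L W ((L : ℤ) • z) κ)⁻¹ (segMain L W Y ((L : ℤ) • z) κ)‖
      ≤ massRemC d L * loopRad d L a * dirL1 Y (box ((2 * d + 2) * L) ((L : ℤ) • z)) := by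
  set q : Site d := (L : ℤ) • z with hq
  set ρ : ℝ := loopRad d L a with hρ
  have hρ0 : 0 ≤ ρ := by rw [hρ]; unfold SpreadLift.loopRad; positivity
  have hρ32 : ρ ≤ 1 / 32 := loopRad_le h512
  have hU1 : ∀ x κ', W x κ' ∈ U1 (Matrix n n ℂ) := fun x κ' => mem_U1_of_unitary (hW x κ')
  have hloop : ∀ r : Fin d → Fin L, ‖((Wcx L W q κ (boxVec L r) : (Matrix n n ℂ)ˣ) : Matrix n n ℂ) - 1‖ ≤ ρ :=
    fun r => norm_Wcx_sub_one_le L hL W hU1 ha h512 hWa q κ r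
  set D : ℝ := dirL1 Y (box ((2 * d + 2) * L) q) with hD
  have hD0 : 0 ≤ D := dirL1_nonneg Y _
  have h := norm_dbarLin_sub_main_le L hL hW Y q κ hρ32 hloop
  have hXq : Qbar L W Y z κ = dbarLin L W Y q κ := rfl
  rw [hXq]
  refine h.trans ?_
  have h1 := loopL1_add_seg_le_box hL Y q κ
  have h2 := treeL1'_le_box hL Y q κ
  have h3 := lnorm_seg_le_box L Y q κ
  rw [← hD] at h1 h2 h3
  have h4 : 1250 * (loopL1 L Y q κ + lnorm Y q (seg κ L)) + 8 * treeL1' L Y q κ + 2 * lnorm Y q (seg κ L) ≤ massRemC d L * D := by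
    unfold massRemC
    nlinarith [loopL1_nonneg L Y q κ, lnorm_nonneg Y q (seg κ L)]
  calc ρ * (1250 * (loopL1 L Y q κ + lnorm Y q (seg κ L)) + 8 * treeL1' L Y q κ + 2 * lnorm Y q (seg κ L))
      ≤ ρ * (massRemC d L * D) := mul_le_mul_of_nonneg_left h4 hρ0
    _ = massRemC d L * ρ * D := by ring

/-! ## §3 Minkowski in the normalised Hilbert–Schmidt currency -/

omit [DecidableEq n] in
/-- **MINKOWSKI** for finite families of matrices in the HS currency: `√(Σ_i ‖A i + B i‖²_{HS∕n}) ≤ √(Σ_i ‖A i‖²_{HS∕n}) + √(Σ_i ‖B i‖²_{HS∕n})`. [folklore] -/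
theorem sqrt_sum_nhsNormSq_add_le {ι : Type*} (s : Finset ι) (A B : ι → Matrix n n ℂ) :
    Real.sqrt (∑ i ∈ s, nhsNormSq (A i + B i)) ≤ Real.sqrt (∑ i ∈ s, nhsNormSq (A i)) + Real.sqrt (∑ i ∈ s, nhsNormSq (B i)) := by
  set α : ℝ := Real.sqrt (∑ i ∈ s, nhsNormSq (A i)) with hα
  set β : ℝ := Real.sqrt (∑ i ∈ s, nhsNormSq (B i)) with hβ
  have hA0 : 0 ≤ ∑ i ∈ s, nhsNormSq (A i) := Finset.sum_nonneg fun _ _ => nhsNormSq_nonneg _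
  have hB0 : 0 ≤ ∑ i ∈ s, nhsNormSq (B i) := Finset.sum_nonneg fun _ _ => nhsNormSq_nonneg _
  have hα0 : 0 ≤ α := Real.sqrt_nonneg _
  have hβ0 : 0 ≤ β := Real.sqrt_nonneg _
  -- the cross terms by Cauchy–Schwarz twice
  have hcross : ∑ i ∈ s, 2 * hsRe (A i) (B i) ≤ 2 * (α * β) := by
    have h1 : ∑ i ∈ s, 2 * hsRe (A i) (B i) ≤ 2 * ∑ i ∈ s, Real.sqrt (nhsNormSq (A i)) * Real.sqrt (nhsNormSq (B i)) := by
      rw [Finset.mul_sum]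
      refine Finset.sum_le_sum fun i _ => ?_
      have h := abs_hsRe_le (A i) (B i)
      have h' := le_abs_self (hsRe (A i) (B i))
      unfold nhsNorm at h
      linarith
    have h2 := Real.sum_sqrt_mul_sqrt_le s (fun i => nhsNormSq_nonneg (A i)) (fun i => nhsNormSq_nonneg (B i))
    rw [← hα, ← hβ] at h2
    linarith
  have hsum : ∑ i ∈ s, nhsNormSq (A i + B i) ≤ (α + β) ^ 2 := by
    calc ∑ i ∈ s, nhsNormSq (A i + B i) = ∑ i ∈ s, (nhsNormSq (A i) + nhsNormSq (B i) + 2 * hsRe (A i) (B i)) :=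
          Finset.sum_congr rfl fun i _ => nhsNormSq_add _ _
      _ = (∑ i ∈ s, nhsNormSq (A i)) + (∑ i ∈ s, nhsNormSq (B i)) + ∑ i ∈ s, 2 * hsRe (A i) (B i) := by
          rw [Finset.sum_add_distrib, Finset.sum_add_distrib]
      _ ≤ α ^ 2 + β ^ 2 + 2 * (α * β) := by
          rw [hα, hβ, Real.sq_sqrt hA0, Real.sq_sqrt hB0]; linarith
      _ = (α + β) ^ 2 := by ring
  calc Real.sqrt (∑ i ∈ s, nhsNormSq (A i + B i)) ≤ Real.sqrt ((α + β) ^ 2) := Real.sqrt_le_sqrt hsum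
    _ = α + β := Real.sqrt_sq (by positivity)

/-! ## §4 On the torus: the two parts, and the one-step mass contraction of the straight part -/

/-- THE VOLUME-INDEPENDENT MULTIPLICITY CONSTANT of the mass remainder: `d · ((2R′+1)^d · d) · (2R′+1)^d`, `R′ = (2d+2)L`. [folklore] -/
def massErrC (d L : ℕ) : ℝ :=
  (d : ℝ) * ((((2 * ((2 * d + 2) * L) + 1) ^ d * d : ℕ) : ℝ) * (((2 * ((2 * d + 2) * L) + 1) ^ d : ℕ) : ℝ))

omit [Fintype n] [DecidableEq n] in
/-- `0 ≤ massErrC d L`. [folklore] -/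
theorem massErrC_nonneg (d L : ℕ) : 0 ≤ massErrC d L := by unfold massErrC; positivity

/-- **THE MAIN TERM ON THE TORUS** (`W` unitary, `Y` of period `L·M`): `Σ_{z∈periodBox M} Σ_κ nhsNormSq (Ad_{V̄⁻¹} segMain L W Y (L•z) κ) ≤ (L²∕L^d)·Σ_{x∈periodBox (L·M)} Σ_κ nhsNormSq (Y x κ)` —
every fine bond is read `L` times with weight `L^{−d}` (block tiling + shift). [folklore] -/
theorem sum_nhsNormSq_Ad_segMain_le [Nonempty n] {L M : ℕ} [NeZero L] (hL : 1 ≤ L) (hM : 1 ≤ M) {W : Site d → Fin d → (Matrix n n ℂ)ˣ}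
    (hW : IsUnitaryCfg W) (hB : ∀ (z : Site d) (κ : Fin d), bavg L W ((L : ℤ) • z) κ ∈ unitaryUnits (Matrix n n ℂ))
    {Y : Site d → Fin d → Matrix n n ℂ} (hYP : IsPeriodicDir Y ((L : ℤ) * M)) :
    ∑ z ∈ periodBox M, ∑ κ : Fin d, nhsNormSq (Ad (bavg L W ((L : ℤ) • z) κ)⁻¹ (segMain L W Y ((L : ℤ) • z) κ))
      ≤ (L : ℝ) ^ 2 / (L : ℝ) ^ d * ∑ x ∈ periodBox (L * M), ∑ κ : Fin d, nhsNormSq (Y x κ) := by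
  classical
  have hL0 : (L : ℝ) ≠ 0 := by exact_mod_cast (NeZero.ne L)
  have hLM1 : 1 ≤ L * M := Nat.one_le_iff_ne_zero.mpr (Nat.mul_ne_zero (by omega) (by omega))
  have hLM : (((L * M : ℕ) : ℤ)) = (L : ℤ) * M := by push_cast; ring
  have hgP : ∀ (κ : Fin d) (x : Site d) (ι : Fin d), nhsNormSq (Y (x + ((L * M : ℕ) : ℤ) • e ι) κ) = nhsNormSq (Y x κ) := by
    intro κ x ι; rw [hLM, hYP x ι κ]
  have hmain : ∀ κ : Fin d, ∑ z ∈ periodBox M, ∑ r : Fin d → Fin L, ∑ i ∈ Finset.range L, nhsNormSq (Y ((L : ℤ) • z + boxVec L r + (i : ℤ) • e κ) κ)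
      = (L : ℝ) * ∑ x ∈ periodBox (L * M), nhsNormSq (Y x κ) := by
    intro κ
    calc ∑ z ∈ periodBox M, ∑ r : Fin d → Fin L, ∑ i ∈ Finset.range L, nhsNormSq (Y ((L : ℤ) • z + boxVec L r + (i : ℤ) • e κ) κ)
        = ∑ z ∈ periodBox M, ∑ i ∈ Finset.range L, ∑ r : Fin d → Fin L, nhsNormSq (Y ((L : ℤ) • z + boxVec L r + (i : ℤ) • e κ) κ) :=
          Finset.sum_congr rfl fun z _ => Finset.sum_comm
      _ = ∑ i ∈ Finset.range L, ∑ z ∈ periodBox M, ∑ r : Fin d → Fin L, nhsNormSq (Y ((L : ℤ) • z + boxVec L r + (i : ℤ) • e κ) κ) :=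
          Finset.sum_comm
      _ = ∑ _i ∈ Finset.range L, ∑ x ∈ periodBox (L * M), nhsNormSq (Y x κ) := by
          refine Finset.sum_congr rfl fun i _ => ?_
          rw [sum_blocks_eq L hL (periodBox M) (fun x => nhsNormSq (Y (x + (i : ℤ) • e κ) κ)), blockSites_periodBox L M hL]
          exact sum_periodBox_shift (L * M) hLM1 (g := fun x => nhsNormSq (Y x κ)) (fun x ι => hgP κ x ι) ((i : ℤ) • e κ)
      _ = (L : ℝ) * ∑ x ∈ periodBox (L * M), nhsNormSq (Y x κ) := by
          rw [Finset.sum_const, Finset.card_range, nsmul_eq_mul]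
  calc ∑ z ∈ periodBox M, ∑ κ : Fin d, nhsNormSq (Ad (bavg L W ((L : ℤ) • z) κ)⁻¹ (segMain L W Y ((L : ℤ) • z) κ))
      ≤ ∑ z ∈ periodBox M, ∑ κ : Fin d, ((L : ℝ) / (L : ℝ) ^ d * ∑ r : Fin d → Fin L, ∑ i ∈ Finset.range L,
          nhsNormSq (Y ((L : ℤ) • z + boxVec L r + (i : ℤ) • e κ) κ)) := by
        refine Finset.sum_le_sum fun z _ => Finset.sum_le_sum fun κ _ => ?_
        rw [nhsNormSq_Ad ((unitaryUnits _).inv_mem (hB z κ))]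
        exact nhsNormSq_segMain_le L hW Y _ κ
    _ = (L : ℝ) / (L : ℝ) ^ d * ∑ κ : Fin d, ((L : ℝ) * ∑ x ∈ periodBox (L * M), nhsNormSq (Y x κ)) := by
        rw [Finset.sum_comm]
        simp only [← Finset.mul_sum, hmain]
    _ = (L : ℝ) ^ 2 / (L : ℝ) ^ d * ∑ x ∈ periodBox (L * M), ∑ κ : Fin d, nhsNormSq (Y x κ) := by
        rw [← Finset.mul_sum, Finset.sum_comm]; ring

/-- **THE REMAINDER ON THE TORUS** (`W` unitary of period `L·M` in the standard small-field class, `Y` of period `L·M`):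
`Σ_{z∈periodBox M} Σ_κ ‖Qbar L W Y z κ − Ad_{V̄⁻¹} segMain (L•z) κ‖² ≤ massErrC d L·(massRemC d L·loopRad d L a)²·dirSq Y (periodBox (L·M))`. [folklore] -/
theorem sum_normSq_Qbar_sub_le [Nonempty n] {L M : ℕ} [NeZero L] (hL : 1 ≤ L) (hM : 1 ≤ M) {W : Site d → Fin d → (Matrix n n ℂ)ˣ}
    (hW : IsUnitaryCfg W) {a : ℝ} (ha : 0 ≤ a) (h512 : 512 * (d + 1) * (d + 4) * (L : ℝ) ^ 2 * a ≤ 1) (hWa : SmallField W a)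
    {Y : Site d → Fin d → Matrix n n ℂ} (hYP : IsPeriodicDir Y ((L : ℤ) * M)) :
    ∑ z ∈ periodBox M, ∑ κ : Fin d, ‖Qbar L W Y z κ - Ad (bavg L W ((L : ℤ) • z) κ)⁻¹ (segMain L W Y ((L : ℤ) • z) κ)‖ ^ 2
      ≤ massErrC d L * (massRemC d L * loopRad d L a) ^ 2 * dirSq Y (periodBox (L * M)) := by
  classical
  set R : ℕ := (2 * d + 2) * L with hR
  set K : ℝ := massRemC d L * loopRad d L a with hK
  have hLM : (((L * M : ℕ) : ℤ)) = (L : ℤ) * M := by push_cast; ring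
  have hmassP : ∀ (x : Site d) (ι : Fin d), (∑ μ : Fin d, ‖Y (x + ((L * M : ℕ) : ℤ) • e ι) μ‖ ^ 2) = ∑ μ : Fin d, ‖Y x μ‖ ^ 2 := by
    intro x ι; rw [hLM]; exact Finset.sum_congr rfl fun μ _ => by rw [hYP x ι μ]
  have hpt : ∀ (z : Site d) (κ : Fin d),
      ‖Qbar L W Y z κ - Ad (bavg L W ((L : ℤ) • z) κ)⁻¹ (segMain L W Y ((L : ℤ) • z) κ)‖ ^ 2
        ≤ K ^ 2 * ((((2 * R + 1) ^ d * d : ℕ) : ℝ) * dirSq Y (box R ((L : ℤ) • z))) := by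
    intro z κ
    have h := norm_Qbar_sub_Ad_segMain_le hL hW ha h512 hWa Y z κ
    have h0 : 0 ≤ ‖Qbar L W Y z κ - Ad (bavg L W ((L : ℤ) • z) κ)⁻¹ (segMain L W Y ((L : ℤ) • z) κ)‖ := norm_nonneg _
    have h2 := pow_le_pow_left₀ h0 h 2
    refine h2.trans ?_
    rw [mul_pow, ← hK, ← hR]
    refine mul_le_mul_of_nonneg_left ?_ (sq_nonneg K)
    have hcs := dirL1_sq_le_card_mul_dirSq Y (box R ((L : ℤ) • z))
    rwa [card_box_eq] at hcs
  have herr : ∑ z ∈ periodBox M, dirSq Y (box R ((L : ℤ) • z)) ≤ (((2 * R + 1) ^ d : ℕ) : ℝ) * dirSq Y (periodBox (L * M)) := by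
    have h := sum_periodBox_box_le L M hL hM R (g := fun x => ∑ μ : Fin d, ‖Y x μ‖ ^ 2) (fun x => Finset.sum_nonneg fun _ _ => sq_nonneg _) hmassP
    unfold T4AveragingDeficitWall.dirSq
    exact_mod_cast h
  calc ∑ z ∈ periodBox M, ∑ κ : Fin d, ‖Qbar L W Y z κ - Ad (bavg L W ((L : ℤ) • z) κ)⁻¹ (segMain L W Y ((L : ℤ) • z) κ)‖ ^ 2
      ≤ ∑ z ∈ periodBox M, ∑ _κ : Fin d, K ^ 2 * ((((2 * R + 1) ^ d * d : ℕ) : ℝ) * dirSq Y (box R ((L : ℤ) • z))) :=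
        Finset.sum_le_sum fun z _ => Finset.sum_le_sum fun κ _ => hpt z κ
    _ = (d : ℝ) * (K ^ 2 * (((2 * R + 1) ^ d * d : ℕ) : ℝ)) * ∑ z ∈ periodBox M, dirSq Y (box R ((L : ℤ) • z)) := by
        simp only [Finset.sum_const, Finset.card_univ, Fintype.card_fin, nsmul_eq_mul, ← Finset.mul_sum]; ring
    _ ≤ (d : ℝ) * (K ^ 2 * (((2 * R + 1) ^ d * d : ℕ) : ℝ)) * ((((2 * R + 1) ^ d : ℕ) : ℝ) * dirSq Y (periodBox (L * M))) :=
        mul_le_mul_of_nonneg_left herr (by positivity)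
    _ = _ := by simp only [massErrC, ← hR]; ring

/-- **THE STRAIGHT PART OF ONE LINEARISED AVERAGING STEP CONTRACTS THE HS MASS BY `L^{(2−d)/2}` UP TO `O(a)`, ROOT FORM** (`W` unitary of period `L·M` in the standard small-field class,
`Y` of period `L·M`):
`√(Σ_{z∈periodBox M} Σ_κ nhsNormSq (Qbar L W Y z κ)) ≤ √(L²∕L^d)·√(Σ_{x∈periodBox (L·M)} Σ_κ nhsNormSq (Y x κ)) + √(massErrC d L)·(massRemC d L·loopRad d L a)·√(dirSq Y (periodBox (L·M)))`
— no multiplicative loss on the main term (Minkowski), the remainder LINEAR in the plaquette radius `a`. [cite: Balaban1985Averaging, (120) p.35] -/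
theorem sqrt_qbar_mass_le_curved [Nonempty n] {L M : ℕ} [NeZero L] (hL : 1 ≤ L) (hM : 1 ≤ M) {W : Site d → Fin d → (Matrix n n ℂ)ˣ}
    (hW : IsUnitaryCfg W) {a : ℝ} (ha : 0 ≤ a) (h512 : 512 * (d + 1) * (d + 4) * (L : ℝ) ^ 2 * a ≤ 1) (hWa : SmallField W a)
    {Y : Site d → Fin d → Matrix n n ℂ} (hYP : IsPeriodicDir Y ((L : ℤ) * M)) :
    Real.sqrt (∑ z ∈ periodBox M, ∑ κ : Fin d, nhsNormSq (Qbar L W Y z κ))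
      ≤ Real.sqrt ((L : ℝ) ^ 2 / (L : ℝ) ^ d) * Real.sqrt (∑ x ∈ periodBox (L * M), ∑ κ : Fin d, nhsNormSq (Y x κ))
        + Real.sqrt (massErrC d L) * (massRemC d L * loopRad d L a) * Real.sqrt (dirSq Y (periodBox (L * M))) := by
  classical
  have hU1 : ∀ x κ', W x κ' ∈ U1 (Matrix n n ℂ) := fun x κ' => mem_U1_of_unitary (hW x κ')
  have hρ32 : loopRad d L a ≤ 1 / 32 := loopRad_le h512
  have hB : ∀ (z : Site d) (κ : Fin d), bavg L W ((L : ℤ) • z) κ ∈ unitaryUnits (Matrix n n ℂ) := fun z κ =>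
    bavg_mem_unitary L hW _ κ fun r => (norm_Wcx_sub_one_le L hL W hU1 ha h512 hWa _ κ r).trans (hρ32.trans (by norm_num))
  have hK0 : 0 ≤ massRemC d L * loopRad d L a := mul_nonneg (massRemC_nonneg d L) (by unfold SpreadLift.loopRad; positivity)
  -- Minkowski over the coarse bonds `(z, κ)`
  set A : Site d × Fin d → Matrix n n ℂ := fun b => Ad (bavg L W ((L : ℤ) • b.1) b.2)⁻¹ (segMain L W Y ((L : ℤ) • b.1) b.2) with hA
  set B : Site d × Fin d → Matrix n n ℂ := fun b => Qbar L W Y b.1 b.2 - A b with hBdef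
  have hsplit : ∑ z ∈ periodBox M, ∑ κ : Fin d, nhsNormSq (Qbar L W Y z κ) = ∑ b ∈ periodBox M ×ˢ (Finset.univ : Finset (Fin d)), nhsNormSq (A b + B b) := by
    rw [Finset.sum_product]
    refine Finset.sum_congr rfl fun z _ => Finset.sum_congr rfl fun κ _ => ?_
    simp only [hBdef, add_sub_cancel]
  rw [hsplit]
  refine (sqrt_sum_nhsNormSq_add_le _ A B).trans (add_le_add ?_ ?_)
  · have h := sum_nhsNormSq_Ad_segMain_le hL hM hW hB hYP
    have h' : ∑ b ∈ periodBox M ×ˢ (Finset.univ : Finset (Fin d)), nhsNormSq (A b)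
        = ∑ z ∈ periodBox M, ∑ κ : Fin d, nhsNormSq (Ad (bavg L W ((L : ℤ) • z) κ)⁻¹ (segMain L W Y ((L : ℤ) • z) κ)) := by
      rw [Finset.sum_product]
    rw [h']
    calc Real.sqrt (∑ z ∈ periodBox M, ∑ κ : Fin d, nhsNormSq (Ad (bavg L W ((L : ℤ) • z) κ)⁻¹ (segMain L W Y ((L : ℤ) • z) κ)))
        ≤ Real.sqrt ((L : ℝ) ^ 2 / (L : ℝ) ^ d * ∑ x ∈ periodBox (L * M), ∑ κ : Fin d, nhsNormSq (Y x κ)) := Real.sqrt_le_sqrt h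
      _ = _ := Real.sqrt_mul (by positivity) _
  · have h := sum_normSq_Qbar_sub_le hL hM hW ha h512 hWa hYP
    have h1 : ∑ b ∈ periodBox M ×ˢ (Finset.univ : Finset (Fin d)), nhsNormSq (B b)
        ≤ ∑ z ∈ periodBox M, ∑ κ : Fin d, ‖Qbar L W Y z κ - Ad (bavg L W ((L : ℤ) • z) κ)⁻¹ (segMain L W Y ((L : ℤ) • z) κ)‖ ^ 2 := by
      rw [Finset.sum_product]
      exact Finset.sum_le_sum fun z _ => Finset.sum_le_sum fun κ _ => nhsNormSq_le_opNorm_sq _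
    calc Real.sqrt (∑ b ∈ periodBox M ×ˢ (Finset.univ : Finset (Fin d)), nhsNormSq (B b))
        ≤ Real.sqrt (massErrC d L * (massRemC d L * loopRad d L a) ^ 2 * dirSq Y (periodBox (L * M))) := Real.sqrt_le_sqrt (h1.trans h)
      _ = Real.sqrt (massErrC d L) * (massRemC d L * loopRad d L a) * Real.sqrt (dirSq Y (periodBox (L * M))) := by
          rw [Real.sqrt_mul (mul_nonneg (massErrC_nonneg d L) (sq_nonneg _)), Real.sqrt_mul (massErrC_nonneg d L), Real.sqrt_sq hK0]

end

end Summit.QuantumFields.BalabanUV.T4Continuum.NE7QbarMassLetter
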